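import Literature.MathematicalPhysics.QuantumFieldTheory.TorusChartFlatCochains
import HarnessLib

/-!
# Route `BalabanIR`, crux `BirComplexStableXYR` (item `stmt-HubbardSuperconductivity-14845`),
# line `fat-gaussian-defect-calculus`: stub U1 `stub_treeGaugeDecomposition`

Helper (`--supports`) for the crux
`Summit.HubbardSuperconductivity.HubbardSuperconductivity.Theses.BalabanIR.BirComplexStableXYR`,
line `fat-gaussian-defect-calculus` (chapter 1, the exact Fröhlich–Spencer unfolding of the torus integral),
stub U1 `stub_treeGaugeDecomposition` (tree-gauge decomposition of integer `1`-cochains).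

**Statement.** On a charted torus `F : TorusChart Λ d` let `T` be the axial comb
`T = {(y, μ) : y_ν = 0 for all ν > μ, y_μ + 1 < N_μ}` (the edges of the lexicographic staircases from the
origin).  For every `1`-cochain `a` there is exactly one `0`-cochain `n` with `n 0 = 0` whose coboundary agrees
with `a` on `T`: `a (y, μ) = n (y + e_μ) - n y` for `(y, μ) ∈ T`.

**Proof.** EXISTENCE: `n := prim a`, the axial primitive (sum of `a` along the lexicographic staircase from `0`).
For a tree edge `(y, μ)` the staircases towards `y + e_μ` and `y` agree in the directions `< μ`, the line in
direction `μ` is one edge longer towards `y + e_μ`, the extra edge being `(trunc μ y + y_μ • e_μ, μ) = (y, μ)`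
because the higher coordinates of `y` vanish, and the lines in the directions `> μ` are empty for both
(`axPrim_add_gen_of_tree`).  UNIQUENESS: the staircase sums only traverse tree edges, so `prim θ` depends only
on `θ|_T` (`axPrim_congr_of_tree`); if `n` solves the problem then `d₀ n` agrees with `a` on `T`, whence
`n x = n x - n 0 = prim (d₀ n) x = prim a x` (`prim_d₀`). [folklore]

Everything used is the landed `TorusChart` API (`TorusChart.lean`, `TorusChartCochains.lean`,
`TorusChartFlatCochains.lean`) plus Mathlib; no definition and no named fact is introduced.
-/

set_option linter.dupNamespace false -- summit = problem name (single-conjunct summit), D-0017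

namespace Summit.HubbardSuperconductivity.HubbardSuperconductivity.Theorems.FSUnfolding

open scoped BigOperators
open Literature.MathematicalPhysics.QuantumFieldTheory

section TreeGauge

variable {Λ : Type*} [AddCommGroup Λ] {d : ℕ} (F : TorusChart Λ d) {A : Type*} [AddCommGroup A]

/-- A site all of whose coordinates in the directions `≥ k` vanish is its own `k`-th staircase corner.
[folklore] -/
theorem trunc_eq_self_of_vanish (k : ℕ) (y : Λ) (hy : ∀ ν : Fin d, k ≤ (ν : ℕ) → F.cval ν y = 0) :
    F.trunc k y = y := by
  refine F.ext_cval fun i => ?_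
  rw [F.cval_trunc]
  split_ifs with hi
  · rfl
  · exact (hy i (not_lt.1 hi)).symm

/-- **Staircase sums towards the two endpoints of a tree edge.**  For a tree edge `(y, μ)` (the coordinates of
`y` in the directions `> μ` vanish and `y_μ + 1 < N_μ`) and ANY `1`-cochain `θ`, after `k` directions the
staircase sum towards `y + e_μ` is the one towards `y` plus the edge value `θ (y, μ)` as soon as direction `μ`
has been traversed (no flatness needed: only tree edges are compared). [folklore] -/
theorem axPrim_add_gen_of_tree (θ : Λ → Fin d → A) (y : Λ) (μ : Fin d)
    (hy : ∀ ν : Fin d, μ < ν → F.cval ν y = 0) (hμ : F.cval μ y + 1 < F.period μ) :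
    ∀ k : ℕ, F.axPrim θ (y + F.gen μ) k = F.axPrim θ y k + (if (μ : ℕ) < k then θ y μ else 0) := by
  intro k
  induction k with
  | zero => simp
  | succ k IH =>
    rw [F.axPrim_succ, F.axPrim_succ, IH]
    by_cases hkd : k < d
    · rw [dif_pos hkd, dif_pos hkd]
      rcases lt_trichotomy (μ : ℕ) k with hlt | heq | hgt
      · -- direction `μ` already traversed: the `k`-lines are empty (`y_k = 0` since `k > μ`)
        have hne : (⟨k, hkd⟩ : Fin d) ≠ μ := Fin.ne_of_val_ne (by simp only; omega)
        have hκy : F.cval ⟨k, hkd⟩ y = 0 := hy ⟨k, hkd⟩ (Fin.lt_def.2 hlt)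
        rw [if_pos hlt, if_pos (Nat.lt_succ_of_lt hlt), F.cval_add_gen_of_ne y hne, hκy, F.lineSum_zero,
          F.lineSum_zero, add_zero, add_zero]
      · -- direction `μ` is direction `k`: one more edge at the end of the `μ`-line, namely `(y, μ)`
        subst heq
        have htr : F.trunc (μ : ℕ) y + F.cval μ y • F.gen μ = y := by
          have h1 := F.trunc_succ hkd y
          have h2 := trunc_eq_self_of_vanish F ((μ : ℕ) + 1) y fun ν hν => hy ν (Fin.lt_def.2 hν)
          simp only [Fin.eta] at h1
          rw [← h1, h2]
        simp only [Fin.eta]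
        rw [if_neg (lt_irrefl _), if_pos (Nat.lt_succ_self _), add_zero, F.trunc_add_gen_of_lt _ y μ hμ,
          if_neg (lt_irrefl _), add_zero, F.cval_add_gen_self_of_lt μ y hμ, F.lineSum_succ, htr, add_assoc]
      · -- direction `μ` not yet traversed: nothing changes
        have hne : (⟨k, hkd⟩ : Fin d) ≠ μ := Fin.ne_of_val_ne (by simp only; omega)
        have h1 : ¬ (μ : ℕ) < k := by omega
        have h2 : ¬ (μ : ℕ) < k + 1 := by omega
        rw [if_neg h1, if_neg h2, add_zero, add_zero, F.trunc_add_gen_of_lt k y μ hμ, if_neg h1, add_zero,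
          F.cval_add_gen_of_ne y hne]
    · -- all directions traversed
      have h2 : (μ : ℕ) < k + 1 := by have := μ.isLt; omega
      have h3 : (μ : ℕ) < k := by have := μ.isLt; omega
      rw [dif_neg hkd, dif_neg hkd, if_pos h3, if_pos h2, add_zero, add_zero]

/-- **The axial primitive integrates any `1`-cochain on the tree edges**: for a tree edge `(y, μ)`,
`prim θ (y + e_μ) = prim θ y + θ (y, μ)`. [folklore] -/
theorem prim_add_gen_of_tree (θ : Λ → Fin d → A) (y : Λ) (μ : Fin d)
    (hy : ∀ ν : Fin d, μ < ν → F.cval ν y = 0) (hμ : F.cval μ y + 1 < F.period μ) :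
    F.prim θ (y + F.gen μ) = F.prim θ y + θ y μ := by
  have h := axPrim_add_gen_of_tree F θ y μ hy hμ d
  rw [if_pos μ.isLt] at h
  exact h

/-- **The staircase sums only see the tree edges**: two `1`-cochains which agree on the axial comb `T` have the
same staircase sums (every edge `(trunc k x + j • e_k, k)`, `j < x_k`, of a staircase is a tree edge).
[folklore] -/
theorem axPrim_congr_of_tree (θ θ' : Λ → Fin d → A)
    (h : ∀ (y : Λ) (μ : Fin d), (∀ ν : Fin d, μ < ν → F.cval ν y = 0) → F.cval μ y + 1 < F.period μ →
      θ y μ = θ' y μ) (x : Λ) : ∀ k : ℕ, F.axPrim θ x k = F.axPrim θ' x k := by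
  intro k
  induction k with
  | zero => rfl
  | succ k IH =>
    rw [F.axPrim_succ, F.axPrim_succ, IH]
    by_cases hkd : k < d
    · rw [dif_pos hkd, dif_pos hkd]
      congr 1
      simp only [TorusChart.lineSum]
      refine Finset.sum_congr rfl fun j hj => ?_
      rw [Finset.mem_range] at hj
      have hcl : F.cval ⟨k, hkd⟩ x < F.period ⟨k, hkd⟩ := F.cval_lt _ _
      have hjlt : j < F.period ⟨k, hkd⟩ := hj.trans hcl
      refine h _ _ (fun ν hν => ?_) ?_
      · have hkν : k < (ν : ℕ) := Fin.lt_def.1 hν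
        have hne : ν ≠ ⟨k, hkd⟩ := Fin.ne_of_val_ne (by simp only; omega)
        rw [F.cval_add_nsmul_gen_of_ne hne, F.cval_trunc, if_neg (by omega)]
      · rw [F.cval_add_nsmul_gen_self, F.cval_trunc, if_neg (lt_irrefl _), zero_add, Nat.mod_eq_of_lt hjlt]
        omega
    · rw [dif_neg hkd, dif_neg hkd]

/-- **Tree-gauge decomposition** (chart form of stub U1): for every `1`-cochain `a` on a charted torus there is
exactly one `0`-cochain `n` with `n 0 = 0` whose coboundary agrees with `a` on the axial comb
`T = {(y, μ) : y_ν = 0 (ν > μ), y_μ + 1 < N_μ}`; it is the axial primitive `prim a`. [folklore] -/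
theorem treeGaugeDecomposition (a : Λ → Fin d → A) :
    ∃! n : Λ → A, n 0 = 0 ∧ ∀ (y : Λ) (μ : Fin d), (∀ ν : Fin d, μ < ν → F.cval ν y = 0) →
      F.cval μ y + 1 < F.period μ → a y μ = n (y + F.gen μ) - n y := by
  refine ⟨F.prim a, ⟨F.prim_origin a, fun y μ hy hμ => ?_⟩, ?_⟩
  · rw [prim_add_gen_of_tree F a y μ hy hμ, add_sub_cancel_left]
  · rintro n ⟨hn0, hn⟩
    funext x
    have h1 : F.prim (F.d₀ n) x = n x := by rw [F.prim_d₀, hn0, sub_zero]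
    have h2 : F.prim (F.d₀ n) x = F.prim a x :=
      axPrim_congr_of_tree F (F.d₀ n) a (fun y μ hy hμ => by rw [F.d₀_apply, hn y μ hy hμ]) x d
    rw [← h1, h2]

end TreeGauge

/-- **stub U1 (M): tree-gauge decomposition of integer `1`-cochains.**  On a charted torus every integer `1`-cochain
`a` is, in exactly one way, `a = a_T + d₀ n` with `n 0 = 0` and `a_T` vanishing on the axial spanning tree
`T = {(y, μ) : y_ν = 0 for all ν > μ, y_μ + 1 < N_μ}` (the edges of the lexicographic staircases from the origin):
equivalently, there is a unique `n` with `n 0 = 0` whose coboundary agrees with `a` on `T` (`n = prim a`, the axial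
primitive; uniqueness because `T` spans). [folklore] -/
theorem stub_treeGaugeDecomposition :
    ∀ (Λ : Type) [AddCommGroup Λ] (d : ℕ) (F : TorusChart Λ d) (a : Λ → Fin d → ℤ),
      ∃! n : Λ → ℤ, n 0 = 0 ∧ ∀ (y : Λ) (μ : Fin d), (∀ ν : Fin d, μ < ν → F.cval ν y = 0) →
        F.cval μ y + 1 < F.period μ → a y μ = n (y + F.gen μ) - n y :=
  fun _ _ _ F a => treeGaugeDecomposition F a

end Summit.HubbardSuperconductivity.HubbardSuperconductivity.Theorems.FSUnfolding
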